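import Summits.AnomalousDissipation.AnomalousDissipation.Theorems.BaireTransferDenseLoudDesignerForcesErgodicModelMixedDerivativeFieldFrame
import Summits.AnomalousDissipation.AnomalousDissipation.Theorems.BaireTransferDenseLoudDesignerForcesErgodicPhaseGevrey
import Literature.Analysis.FluidPDE.TorusNSDifferenceGevreySmoothing
import Literature.Analysis.FunctionSpaces.TorusGevreyLimit
import Literature.Analysis.Calculus.MixedDerivFromPartials

/-!
# Set-up of the mixed field of the smooth model: the time-derivative field through classical solutions,
# uniform Gevrey bounds after a warm-up, Lipschitz dependence in Gevrey norm, and smooth representatives of the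
# space derivative (tools for the registered stub S6c₂ `stub_modelMixedDerivativeFieldTools`, line
# ergodic-budget-selection-closing, block N-R of the crux `DenseLoudDesignerForces`)

Summit-side glue.  For the model map `g = F.modelMap ν xF U'` whose orbits from `U` are, for positive times, frame
preimages of classical solutions `u_y` of NS_ν(f_c) with mean-zero slices and a uniform enstrophy level (the hypothesis
`hclass` of S6c₁/S6c₂, produced by S6h), given as a CHOSEN family `u : Hsp → ℝ → T³ → ℝ³`:

* `modelMap_eq_frame` — `g s y = S([u_y s] − [Δu_y s])` for `s ∈ (0, 3]`;
* `hasDerivAt_modelMap` / `continuousOn_deriv_modelMap` — the orbit is differentiable at `s ∈ (0, 3)` with derivative the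
  frame of `∂ₜu_y(s)` (`ModelFrame.hasDerivAt_frameCurve`), and `s ↦ deriv (g · y) s` is continuous on `(0, 3)`;
* `exists_gevrey_modelMap` — a uniform Gevrey bound of `u_y(s)`, `s ≥ 2a`, `y ∈ U` (E9 Foias–Temam smoothing at the
  enstrophy level `E₂`, window length `a`, force band-limited);
* `exists_gevrey_sub_modelMap` — Gevrey bound of `u_y(s) − u_{y'}(s)`, `s ≥ 3a`, by `C₂ ‖g(s − a) y − g(s − a) y'‖²`
  (`Torus.IsClassicalNSSolutionOn.gevrey_sub_of_gevreyBound` and the frame-norm identity);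
* `exists_box_lipschitz_modelMap` — `y ↦ g r y` is Lipschitz on a ball, uniformly for `r` near `r₀ ∈ (0, 3)` (the
  derivative field `W` is bounded near `(r₀, y₀)` by joint continuity; mean value inequality);
* `exists_smooth_rep_fderiv` — `S(W(s, y) h)` is the state of a smooth honest field with Gevrey level `C ‖h‖²`: the
  difference quotients `(u_{y+εh}(s) − u_y(s))/ε` are Gevrey-bounded by `C‖h‖²` and converge in `L²`
  (`HasFDerivAt.lim`), so the compactness of Gevrey balls identifies the limit (`Torus.exists_smooth_rep_of_tendsto_of_gevrey_bound`).

Nothing is asserted; no definition is added.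
-/

set_option linter.dupNamespace false

noncomputable section

open Set Function MeasureTheory Filter Metric
open scoped InnerProductSpace RealInnerProductSpace Topology ContDiff

namespace Summit.AnomalousDissipation.AnomalousDissipation.Theorems.DenseLoudDesignerForces.Ergodic

open Literature.Analysis.FunctionSpaces Literature.Analysis.FunctionSpaces.Torus
open Literature.Analysis.FluidPDE Literature.Analysis.FluidPDE.Torus
open Summit.AnomalousDissipation.AnomalousDissipation.Theses.BaireTransfer
open Summit.AnomalousDissipation.AnomalousDissipation.Theorems.DenseLoudDesignerForces.Negative

section Setup

variable {S : Finset (Fin 3 → ℤ)} {c : ↥S → (EuclideanSpace ℂ (Fin 3))} {ν : ℝ} (F : ModelFrame) (xF : Hsp) {U U' : Set Hsp}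
  (u : Hsp → ℝ → (UnitAddTorus (Fin 3)) → (EuclideanSpace ℝ (Fin 3))) (p : Hsp → ℝ → (UnitAddTorus (Fin 3)) → ℝ)

/-- **The model orbit is the frame curve of the classical solution**: `g s y = S([u_y s] − [Δu_y s])` for `s ∈ (0, 3]`
(frame preimage of an honest state, `eq_frame_apply_of_frame_apply_eq_stateOf`). [folklore] -/
theorem modelMap_eq_frame (hsol : ∀ y ∈ U, IsClassicalNSSolutionOn (Ioc 0 3) ν (fun _ => force S c) (u y) (p y))
    (hzm : ∀ y ∈ U, ∀ t ∈ Ioc (0 : ℝ) 3, HasZeroMean (u y t))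
    (hSu : ∀ y ∈ U, ∀ t ∈ Ioc (0 : ℝ) 3, F.S (F.modelMap ν xF U' t y) = stateOf (u y t)) {y : Hsp} (hy : y ∈ U) {s : ℝ}
    (hs : s ∈ Ioc (0 : ℝ) 3) :
    F.modelMap ν xF U' s y = F.S (stateOf (u y s) - stateOf (laplacian (u y s))) :=
  eq_frame_apply_of_frame_apply_eq_stateOf F.b F.hmodes F.hS ((hsol y hy).smooth_velocity.isSmooth_slice hs)
    ((hsol y hy).divFree s hs) (hzm y hy s hs) (hSu y hy s hs)

/-- The classical solution restricted to a closed window `[a, b] ⊂ (0, 3]`. [folklore] -/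
theorem isClassicalNSSolutionOn_window (hsol : ∀ y ∈ U, IsClassicalNSSolutionOn (Ioc 0 3) ν (fun _ => force S c) (u y) (p y))
    {y : Hsp} (hy : y ∈ U) {a b : ℝ} (ha : 0 < a) (hab : a < b) (hb : b ≤ 3) :
    IsClassicalNSSolutionOn (Icc a b) ν (fun _ => force S c) (u y) (p y) :=
  (hsol y hy).mono (fun _ hs => ⟨ha.trans_le hs.1, hs.2.trans hb⟩) (uniqueDiffOn_Icc hab)

/-- **The orbit is differentiable in time at `s ∈ (0, 3)`, with derivative the frame of `∂ₜu_y(s)`** (two-sided time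
derivative `Torus.timeDeriv`): on a window `[s/2, (s + 3)/2]` the orbit is the explicit frame curve
(`modelMap_eq_frame`), differentiable at the interior time `s` (`ModelFrame.hasDerivAt_frameCurve`), and the one-sided
window derivative is the two-sided one there. [folklore] -/
theorem hasDerivAt_modelMap (hsol : ∀ y ∈ U, IsClassicalNSSolutionOn (Ioc 0 3) ν (fun _ => force S c) (u y) (p y))
    (hzm : ∀ y ∈ U, ∀ t ∈ Ioc (0 : ℝ) 3, HasZeroMean (u y t))
    (hSu : ∀ y ∈ U, ∀ t ∈ Ioc (0 : ℝ) 3, F.S (F.modelMap ν xF U' t y) = stateOf (u y t)) {y : Hsp} (hy : y ∈ U) {s : ℝ}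
    (hs : s ∈ Ioo (0 : ℝ) 3) :
    HasDerivAt (fun r => F.modelMap ν xF U' r y)
      (F.S (stateOf (Torus.timeDeriv (u y) s) - stateOf (laplacian (Torus.timeDeriv (u y) s)))) s := by
  have ha : 0 < s / 2 := by linarith [hs.1]
  have hab : s / 2 < (s + 3) / 2 := by linarith [hs.2]
  have hb : (s + 3) / 2 ≤ 3 := by linarith [hs.2]
  have hsI : s ∈ Ioo (s / 2) ((s + 3) / 2) := ⟨by linarith [hs.1], by linarith [hs.2]⟩
  have hw := isClassicalNSSolutionOn_window u p hsol hy ha hab hb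
  have hzm' : ∀ r ∈ Icc (s / 2) ((s + 3) / 2), HasZeroMean (u y r) := fun r hr =>
    hzm y hy r ⟨ha.trans_le hr.1, hr.2.trans hb⟩
  have h := F.hasDerivAt_frameCurve hab hw hzm' hsI
  have hint : Torus.timeDerivWithin (Icc (s / 2) ((s + 3) / 2)) (u y) s = Torus.timeDeriv (u y) s := by
    funext x
    exact Torus.timeDerivWithin_of_mem_interior (by rw [interior_Icc]; exact hsI) x
  rw [hint] at h
  refine h.congr_of_eventuallyEq ?_
  filter_upwards [Ioo_mem_nhds hsI.1 hsI.2] with r hr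
  exact modelMap_eq_frame F xF u p hsol hzm hSu hy ⟨ha.trans hr.1, hr.2.le.trans hb⟩

/-- **The time-derivative field `s ↦ deriv (g · y) s` is continuous on `(0, 3)`** for `y ∈ U`: near `s₀` it is the frame
curve of `∂ₜu_y` on a window (`hasDerivAt_modelMap`), which is continuous (`ModelFrame.continuousOn_frameDerivCurve`).
[folklore] -/
theorem continuousOn_deriv_modelMap (hsol : ∀ y ∈ U, IsClassicalNSSolutionOn (Ioc 0 3) ν (fun _ => force S c) (u y) (p y))
    (hzm : ∀ y ∈ U, ∀ t ∈ Ioc (0 : ℝ) 3, HasZeroMean (u y t))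
    (hSu : ∀ y ∈ U, ∀ t ∈ Ioc (0 : ℝ) 3, F.S (F.modelMap ν xF U' t y) = stateOf (u y t)) {y : Hsp} (hy : y ∈ U) :
    ContinuousOn (fun s => deriv (fun r => F.modelMap ν xF U' r y) s) (Ioo (0 : ℝ) 3) := by
  intro s₀ hs₀
  have ha : 0 < s₀ / 2 := by linarith [hs₀.1]
  have hab : s₀ / 2 < (s₀ + 3) / 2 := by linarith [hs₀.2]
  have hb : (s₀ + 3) / 2 ≤ 3 := by linarith [hs₀.2]
  have hsI : s₀ ∈ Ioo (s₀ / 2) ((s₀ + 3) / 2) := ⟨by linarith [hs₀.1], by linarith [hs₀.2]⟩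
  have hw := isClassicalNSSolutionOn_window u p hsol hy ha hab hb
  have hzm' : ∀ r ∈ Icc (s₀ / 2) ((s₀ + 3) / 2), HasZeroMean (u y r) := fun r hr =>
    hzm y hy r ⟨ha.trans_le hr.1, hr.2.trans hb⟩
  have hc := (F.continuousOn_frameDerivCurve hab hw hzm').continuousAt (Icc_mem_nhds hsI.1 hsI.2)
  refine (hc.congr ?_).continuousWithinAt
  filter_upwards [Ioo_mem_nhds hsI.1 hsI.2] with s hs
  have hs3 : s ∈ Ioo (0 : ℝ) 3 := ⟨ha.trans hs.1, by linarith [hs.2]⟩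
  rw [(hasDerivAt_modelMap F xF u p hsol hzm hSu hy hs3).deriv]
  have hint : Torus.timeDerivWithin (Icc (s₀ / 2) ((s₀ + 3) / 2)) (u y) s = Torus.timeDeriv (u y) s := by
    funext x
    exact Torus.timeDerivWithin_of_mem_interior (by rw [interior_Icc]; exact hs) x
  rw [hint]

/-- **Uniform Gevrey bound of the orbits after a warm-up** (E9, Foias–Temam smoothing at the enstrophy level `E₂` with the
band-limited designer force): for `a > 0` there are `σ₁ > 0`, `C₁` with `∑_{k∈S'} e^{2σ₁|k|}‖𝓕(u_y(s))(k)‖² ≤ C₁` for all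
`y ∈ U`, `s ∈ [2a, 3]` (window `[s − a, s] ⊂ (0, 3]`). [cite: FoiasTemam1989, Thm 1.1] -/
theorem exists_gevrey_modelMap (hν : 0 < ν)
    (hsol : ∀ y ∈ U, IsClassicalNSSolutionOn (Ioc 0 3) ν (fun _ => force S c) (u y) (p y))
    (hzm : ∀ y ∈ U, ∀ t ∈ Ioc (0 : ℝ) 3, HasZeroMean (u y t)) {E₂ : ℝ} (hE : ∀ y ∈ U, ∀ t ∈ Ioc (0 : ℝ) 3, gradNormSq (u y t) ≤ E₂)
    {a : ℝ} (ha : 0 < a) :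
    ∃ σ₁ : ℝ, 0 < σ₁ ∧ ∃ C₁ : ℝ, ∀ y ∈ U, ∀ s ∈ Icc (2 * a) 3, ∀ S' : Finset (Fin 3 → ℤ),
      ∑ k ∈ S', Real.exp (2 * σ₁ * Real.sqrt (freqNormSq k)) *
        ‖UnitAddTorus.mFourierCoeff (EuclideanSpace.complexify ∘ u y s) k‖ ^ 2 ≤ C₁ := by
  classical
  obtain ⟨σ, hσ, C, hC⟩ := IsClassicalNSSolutionOn.gevrey_of_gradNormSq_le (d := Fin 3) (Fintype.card_fin 3).le hν E₂ a
    (∑ k ∈ S ∪ S.image (fun k => -k), Real.exp (a * Real.sqrt (freqNormSq k)) ^ 2 *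
      (freqNormSq k * ‖UnitAddTorus.mFourierCoeff (EuclideanSpace.complexify ∘ force S c) k‖ ^ 2)) ha
  refine ⟨σ, hσ, C, fun y hy s hs S' => ?_⟩
  have h0 : 0 < s - a := by linarith [hs.1]
  have hlt : s - a < s - a + a := by linarith
  have hb : s - a + a ≤ 3 := by linarith [hs.2]
  have hw := isClassicalNSSolutionOn_window u p hsol hy h0 hlt hb
  have h := hC hw (fun r hr => hzm y hy r ⟨h0.trans_le hr.1, hr.2.trans hb⟩)
    (fun r hr => hE y hy r ⟨h0.trans_le hr.1, hr.2.trans hb⟩) (fun _ _ R => force_gevreyLevel_freqBall_le S c a R) S'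
  rwa [sub_add_cancel] at h

/-- **Lipschitz dependence of the orbit in Gevrey norm** (`Torus.IsClassicalNSSolutionOn.gevrey_sub_of_gevreyBound` along the
uniformly Gevrey windows `[s − a, s]`, `s ≥ 3a`, and the frame-norm identity for the `H¹` energy of the difference at the
initial time of the window): there are `σ₂ > 0`, `C₂` with
`∑_{k∈S'} e^{2σ₂|k|}‖𝓕(u_y(s) − u_{y'}(s))(k)‖² ≤ C₂ ‖g(s − a) y − g(s − a) y'‖²` for `y, y' ∈ U`, `s ∈ [3a, 3]`.
[cite: FoiasTemam1989, Thm 1.1 and Lemma 2.1] -/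
theorem exists_gevrey_sub_modelMap (hν : 0 < ν)
    (hsol : ∀ y ∈ U, IsClassicalNSSolutionOn (Ioc 0 3) ν (fun _ => force S c) (u y) (p y))
    (hzm : ∀ y ∈ U, ∀ t ∈ Ioc (0 : ℝ) 3, HasZeroMean (u y t))
    (hSu : ∀ y ∈ U, ∀ t ∈ Ioc (0 : ℝ) 3, F.S (F.modelMap ν xF U' t y) = stateOf (u y t))
    {a σ₁ C₁ : ℝ} (ha : 0 < a) (hσ₁ : 0 < σ₁)
    (hG : ∀ y ∈ U, ∀ s ∈ Icc (2 * a) 3, ∀ S' : Finset (Fin 3 → ℤ), ∑ k ∈ S', Real.exp (2 * σ₁ * Real.sqrt (freqNormSq k)) *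
        ‖UnitAddTorus.mFourierCoeff (EuclideanSpace.complexify ∘ u y s) k‖ ^ 2 ≤ C₁) :
    ∃ σ₂ : ℝ, 0 < σ₂ ∧ ∃ C₂ : ℝ, 0 ≤ C₂ ∧ ∀ y ∈ U, ∀ y' ∈ U, ∀ s ∈ Icc (3 * a) 3, ∀ S' : Finset (Fin 3 → ℤ),
      ∑ k ∈ S', Real.exp (2 * σ₂ * Real.sqrt (freqNormSq k)) *
        ‖UnitAddTorus.mFourierCoeff (EuclideanSpace.complexify ∘ fun x => u y s x - u y' s x) k‖ ^ 2 ≤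
        C₂ * ‖F.modelMap ν xF U' (s - a) y - F.modelMap ν xF U' (s - a) y'‖ ^ 2 := by
  obtain ⟨σ₂, hσ₂, C, hC⟩ := IsClassicalNSSolutionOn.gevrey_sub_of_gevreyBound (d := Fin 3) hν σ₁ C₁ a hσ₁ ha
  refine ⟨σ₂, hσ₂, max C 0, le_max_right _ _, fun y hy y' hy' s hs S' => ?_⟩
  have h0 : 0 < s - a := by linarith [hs.1]
  have hlt : s - a < s - a + a := by linarith
  have hb : s - a + a ≤ 3 := by linarith [hs.2]
  have hI : ∀ r ∈ Icc (s - a) (s - a + a), r ∈ Ioc (0 : ℝ) 3 := fun r hr => ⟨h0.trans_le hr.1, hr.2.trans hb⟩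
  have hI2 : ∀ r ∈ Icc (s - a) (s - a + a), r ∈ Icc (2 * a) 3 := fun r hr => ⟨by linarith [hr.1, hs.1], hr.2.trans hb⟩
  have hw := isClassicalNSSolutionOn_window u p hsol hy h0 hlt hb
  have hw' := isClassicalNSSolutionOn_window u p hsol hy' h0 hlt hb
  have h := hC hw hw' (fun r hr => hzm y hy r (hI r hr)) (fun r hr => hzm y' hy' r (hI r hr))
    (fun r hr S'' => hG y hy r (hI2 r hr) S'') (fun r hr S'' => hG y' hy' r (hI2 r hr) S'') S'
  rw [sub_add_cancel] at h
  have hsa : s - a ∈ Ioc (0 : ℝ) 3 := ⟨h0, by linarith [hs.2]⟩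
  have hv := (hsol y hy).smooth_velocity.isSmooth_slice hsa
  have hv' := (hsol y' hy').smooth_velocity.isSmooth_slice hsa
  have hnorm : (∫ x, ‖u y (s - a) x - u y' (s - a) x‖ ^ 2) + gradNormSq (fun x => u y (s - a) x - u y' (s - a) x) =
      ‖F.modelMap ν xF U' (s - a) y - F.modelMap ν xF U' (s - a) y'‖ ^ 2 := by
    rw [modelMap_eq_frame F xF u p hsol hzm hSu hy hsa, modelMap_eq_frame F xF u p hsol hzm hSu hy' hsa,
      F.norm_frame_sub_sq hv ((hsol y hy).divFree _ hsa) (hzm y hy _ hsa) hv' ((hsol y' hy').divFree _ hsa) (hzm y' hy' _ hsa)]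
  rw [hnorm] at h
  exact h.trans (mul_le_mul_of_nonneg_right (le_max_left C 0) (sq_nonneg _))

-- the operator-norm structure on `Hsp →L[ℝ] Hsp` is slow to synthesise through the submodule `Hsp`
set_option synthInstance.maxHeartbeats 400000 in
/-- **The orbit map is Lipschitz on a ball, uniformly for times near `r₀ ∈ (0, 3)`**: the derivative field
`W(r, y) = fderiv (g r ·) y` is bounded near `(r₀, y₀)` by joint continuity (`hW`), and the mean value inequality on the
convex ball applies (`y ↦ g r y` is smooth on `U`). [folklore] -/
theorem exists_box_lipschitz_modelMap (hU : IsOpen U)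
    (hsmooth : ∀ t ∈ Icc (0 : ℝ) 3, ContDiffOn ℝ ∞ (fun y => F.modelMap ν xF U' t y) U)
    (hW : ContinuousOn (fun q : ℝ × Hsp => fderiv ℝ (fun y => F.modelMap ν xF U' q.1 y) q.2) (Ioc (0 : ℝ) 3 ×ˢ U))
    {r₀ : ℝ} {y₀ : Hsp} (hr₀ : r₀ ∈ Ioo (0 : ℝ) 3) (hy₀ : y₀ ∈ U) :
    ∃ ε > (0 : ℝ), ∃ ρ > (0 : ℝ), ∃ L : ℝ, 0 ≤ L ∧ Icc (r₀ - ε) (r₀ + ε) ⊆ Ioo (0 : ℝ) 3 ∧ ball y₀ ρ ⊆ U ∧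
      ∀ r ∈ Icc (r₀ - ε) (r₀ + ε), ∀ y ∈ ball y₀ ρ, ∀ y' ∈ ball y₀ ρ,
        ‖F.modelMap ν xF U' r y - F.modelMap ν xF U' r y'‖ ≤ L * ‖y - y'‖ := by
  have hW' : ContinuousOn (fun q : ℝ × Hsp => fderiv ℝ (fun y => F.modelMap ν xF U' q.1 y) q.2) (Ioo (0 : ℝ) 3 ×ˢ U) :=
    hW.mono (prod_mono Ioo_subset_Ioc_self Subset.rfl)
  obtain ⟨ε, hε, ρ, hρ, hIcc, hball, hbound⟩ :=
    Literature.Analysis.Calculus.exists_box_norm_le_of_continuousOn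
      (M := fun r z => fderiv ℝ (fun y' => F.modelMap ν xF U' r y') z) hU hW' hr₀ hy₀
  refine ⟨ε, hε, ρ, hρ, ‖fderiv ℝ (fun y => F.modelMap ν xF U' r₀ y) y₀‖ + 1, by positivity, hIcc, hball,
    fun r hr y hy y' hy' => ?_⟩
  have hr3 : r ∈ Icc (0 : ℝ) 3 := ⟨(hIcc hr).1.le, (hIcc hr).2.le⟩
  have hdiff : ∀ z ∈ ball y₀ ρ, HasFDerivWithinAt (fun y => F.modelMap ν xF U' r y)
      (fderiv ℝ (fun y => F.modelMap ν xF U' r y) z) (ball y₀ ρ) z := fun z hz =>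
    (((hsmooth r hr3).contDiffAt (hU.mem_nhds (hball hz))).differentiableAt (by simp)).hasFDerivAt.hasFDerivWithinAt
  exact (convex_ball y₀ ρ).norm_image_sub_le_of_norm_hasFDerivWithin_le hdiff (fun z hz => hbound r hr z hz) hy' hy

/-- Fourier coefficients of a real multiple of a real field: `𝓕(complexify ∘ (c • v))(k) = c • 𝓕(complexify ∘ v)(k)`, hence
`‖𝓕(complexify ∘ (c • v))(k)‖² = c² ‖𝓕(complexify ∘ v)(k)‖²`. [folklore] -/
theorem norm_mFourierCoeff_const_smul_sq (v : (UnitAddTorus (Fin 3)) → (EuclideanSpace ℝ (Fin 3))) (c₀ : ℝ) (k : Fin 3 → ℤ) :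
    ‖UnitAddTorus.mFourierCoeff (EuclideanSpace.complexify ∘ fun x => c₀ • v x) k‖ ^ 2 =
      c₀ ^ 2 * ‖UnitAddTorus.mFourierCoeff (EuclideanSpace.complexify ∘ v) k‖ ^ 2 := by
  have hfun : (EuclideanSpace.complexify ∘ fun x => c₀ • v x) = (c₀ : ℂ) • (EuclideanSpace.complexify ∘ v) := by
    funext x
    ext i
    simp [EuclideanSpace.complexify_apply]
  rw [hfun, mFourierCoeff_const_smul, norm_smul, mul_pow, Complex.norm_real, Real.norm_eq_abs, sq_abs]

/-- **The space derivative of the model map is the state of a smooth honest Gevrey-bounded field.**  In the setting of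
`exists_gevrey_sub_modelMap` (Gevrey–Lipschitz constant `C₂` on `[3a, 3]`) and `exists_box_lipschitz_modelMap` (Lipschitz
constant `L` of `y ↦ g r y` on `ball y₀ ρ` for `r ∈ [r₀ − ε, r₀ + ε]`), for `s ∈ [3a, 3]` with `s − a ∈ [r₀ − ε, r₀ + ε]`,
`y ∈ ball y₀ (ρ/2)` and every `h`, the state `S (W(s, y) h)` (`W(s, y) = fderiv (g s ·) y`) is `[w]` for a smooth,
divergence-free, mean-zero `w` with `∑_{k∈S'} e^{2σ₂|k|}‖ŵ(k)‖² ≤ C₂ L² ‖h‖²`: the difference quotients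
`(u_{y + εₙh}(s) − u_y(s))/εₙ` are honest with this Gevrey bound and converge in `L²` to `rep (S (W(s, y) h))`
(`HasFDerivAt.lim` through the bounded `S`), and `Torus.exists_smooth_rep_of_tendsto_of_gevrey_bound` identifies the limit.
[folklore] -/
theorem exists_smooth_rep_fderiv (hsol : ∀ y ∈ U, IsClassicalNSSolutionOn (Ioc 0 3) ν (fun _ => force S c) (u y) (p y))
    (hzm : ∀ y ∈ U, ∀ t ∈ Ioc (0 : ℝ) 3, HasZeroMean (u y t))
    (hSu : ∀ y ∈ U, ∀ t ∈ Ioc (0 : ℝ) 3, F.S (F.modelMap ν xF U' t y) = stateOf (u y t)) (hU : IsOpen U)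
    (hsmooth : ∀ t ∈ Icc (0 : ℝ) 3, ContDiffOn ℝ ∞ (fun y => F.modelMap ν xF U' t y) U)
    {σ₂ C₂ a : ℝ} (hσ₂ : 0 < σ₂) (hC₂ : 0 ≤ C₂)
    (hLipG : ∀ y ∈ U, ∀ y' ∈ U, ∀ s ∈ Icc (3 * a) 3, ∀ S' : Finset (Fin 3 → ℤ),
      ∑ k ∈ S', Real.exp (2 * σ₂ * Real.sqrt (freqNormSq k)) *
        ‖UnitAddTorus.mFourierCoeff (EuclideanSpace.complexify ∘ fun x => u y s x - u y' s x) k‖ ^ 2 ≤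
        C₂ * ‖F.modelMap ν xF U' (s - a) y - F.modelMap ν xF U' (s - a) y'‖ ^ 2)
    {ε ρ L r₀ : ℝ} {y₀ : Hsp} (hρ : 0 < ρ) (hballU : ball y₀ ρ ⊆ U)
    (hLip : ∀ r ∈ Icc (r₀ - ε) (r₀ + ε), ∀ y ∈ ball y₀ ρ, ∀ y' ∈ ball y₀ ρ,
      ‖F.modelMap ν xF U' r y - F.modelMap ν xF U' r y'‖ ≤ L * ‖y - y'‖)
    {s : ℝ} (hs : s ∈ Icc (3 * a) 3) (hs0 : 0 < s) (hsr : s - a ∈ Icc (r₀ - ε) (r₀ + ε)) {y : Hsp} (hy : y ∈ ball y₀ (ρ / 2))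
    (h : Hsp) :
    ∃ w : (UnitAddTorus (Fin 3)) → (EuclideanSpace ℝ (Fin 3)), IsSmooth w ∧ IsDivFree w ∧ HasZeroMean w ∧
      (∀ S' : Finset (Fin 3 → ℤ), ∑ k ∈ S', Real.exp (2 * σ₂ * Real.sqrt (freqNormSq k)) *
        ‖UnitAddTorus.mFourierCoeff (EuclideanSpace.complexify ∘ w) k‖ ^ 2 ≤ C₂ * L ^ 2 * ‖h‖ ^ 2) ∧
      stateOf w = F.S (fderiv ℝ (fun y' => F.modelMap ν xF U' s y') y h) := by
  have hyρ : y ∈ ball y₀ ρ := ball_subset_ball (by linarith) hy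
  have hyU : y ∈ U := hballU hyρ
  have hs3 : s ∈ Ioc (0 : ℝ) 3 := ⟨hs0, hs.2⟩
  -- the step sizes `εₙ → 0⁺` keeping `y + εₙ h` in the ball, and `cₙ = εₙ⁻¹`
  set e : ℕ → ℝ := fun n => ρ / (2 * (‖h‖ + 1) * ((n : ℝ) + 2)) with he
  have hepos : ∀ n, 0 < e n := fun n => by rw [he]; positivity
  have hmem : ∀ n, y + e n • h ∈ ball y₀ ρ := by
    intro n
    rw [mem_ball, dist_eq_norm]
    have h1 : ‖e n • h‖ < ρ / 2 := by
      rw [norm_smul, Real.norm_eq_abs, abs_of_pos (hepos n), he]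
      have hn2 : (1 : ℝ) ≤ (n : ℝ) + 2 := by linarith [(Nat.cast_nonneg n : (0 : ℝ) ≤ n)]
      rw [div_mul_eq_mul_div, div_lt_div_iff₀ (by positivity) (by norm_num)]
      have hlt : ‖h‖ * 2 < 2 * (‖h‖ + 1) * ((n : ℝ) + 2) := by
        nlinarith [norm_nonneg h, mul_le_mul_of_nonneg_left hn2 (by positivity : (0 : ℝ) ≤ 2 * (‖h‖ + 1))]
      calc ρ * ‖h‖ * 2 = ρ * (‖h‖ * 2) := by ring
        _ < ρ * (2 * (‖h‖ + 1) * ((n : ℝ) + 2)) := mul_lt_mul_of_pos_left hlt hρ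
    have h2 : dist y y₀ < ρ / 2 := mem_ball.1 hy
    rw [dist_eq_norm] at h2
    calc ‖y + e n • h - y₀‖ = ‖e n • h + (y - y₀)‖ := by abel_nf
      _ ≤ ‖e n • h‖ + ‖y - y₀‖ := norm_add_le _ _
      _ < ρ := by linarith
  have hmemU : ∀ n, y + e n • h ∈ U := fun n => hballU (hmem n)
  have hc : Tendsto (fun n => ‖(e n)⁻¹‖) atTop atTop := by
    have h1 : Tendsto (fun n : ℕ => 2 * (‖h‖ + 1) / ρ * ((n : ℝ) + 2)) atTop atTop :=
      (tendsto_atTop_add_const_right _ _ tendsto_natCast_atTop_atTop).const_mul_atTop (by positivity)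
    refine h1.congr fun n => ?_
    rw [Real.norm_eq_abs, abs_of_pos (inv_pos.2 (hepos n)), he]
    field_simp
  -- the difference quotients: honest, Gevrey-bounded by `C₂ L² ‖h‖²`
  set v : ℕ → (UnitAddTorus (Fin 3)) → (EuclideanSpace ℝ (Fin 3)) := fun n x => (e n)⁻¹ • (u (y + e n • h) s x - u y s x)
    with hv
  have hhon : ∀ n, IsSmooth (fun x => u (y + e n • h) s x - u y s x) ∧ IsDivFree (fun x => u (y + e n • h) s x - u y s x) ∧
      HasZeroMean (fun x => u (y + e n • h) s x - u y s x) := fun n =>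
    honest_sub ((hsol _ (hmemU n)).smooth_velocity.isSmooth_slice hs3) ((hsol _ (hmemU n)).divFree s hs3) (hzm _ (hmemU n) s hs3)
      ((hsol y hyU).smooth_velocity.isSmooth_slice hs3) ((hsol y hyU).divFree s hs3) (hzm y hyU s hs3)
  have hvhon : ∀ n, IsSmooth (v n) ∧ IsDivFree (v n) ∧ HasZeroMean (v n) := fun n =>
    honest_const_smul (hhon n).1 (hhon n).2.1 (hhon n).2.2 _
  have hvG : ∀ n, ∀ S' : Finset (Fin 3 → ℤ), ∑ k ∈ S', Real.exp (2 * σ₂ * Real.sqrt (freqNormSq k)) *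
      ‖UnitAddTorus.mFourierCoeff (EuclideanSpace.complexify ∘ v n) k‖ ^ 2 ≤ C₂ * L ^ 2 * ‖h‖ ^ 2 := by
    intro n S'
    have hG := hLipG _ (hmemU n) y hyU s hs S'
    have hLn := hLip (s - a) hsr _ (hmem n) y hyρ
    rw [add_sub_cancel_left, norm_smul, Real.norm_eq_abs, abs_of_pos (hepos n)] at hLn
    have hsq : ‖F.modelMap ν xF U' (s - a) (y + e n • h) - F.modelMap ν xF U' (s - a) y‖ ^ 2 ≤ (L * (e n * ‖h‖)) ^ 2 :=
      pow_le_pow_left₀ (norm_nonneg _) hLn 2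
    calc ∑ k ∈ S', Real.exp (2 * σ₂ * Real.sqrt (freqNormSq k)) * ‖UnitAddTorus.mFourierCoeff (EuclideanSpace.complexify ∘ v n) k‖ ^ 2
        = (e n)⁻¹ ^ 2 * ∑ k ∈ S', Real.exp (2 * σ₂ * Real.sqrt (freqNormSq k)) *
            ‖UnitAddTorus.mFourierCoeff (EuclideanSpace.complexify ∘ fun x => u (y + e n • h) s x - u y s x) k‖ ^ 2 := by
          rw [Finset.mul_sum]
          refine Finset.sum_congr rfl fun k _ => ?_
          rw [hv, norm_mFourierCoeff_const_smul_sq]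
          ring
      _ ≤ (e n)⁻¹ ^ 2 * (C₂ * (L * (e n * ‖h‖)) ^ 2) :=
          mul_le_mul_of_nonneg_left (hG.trans (mul_le_mul_of_nonneg_left hsq hC₂)) (sq_nonneg _)
      _ = C₂ * L ^ 2 * ‖h‖ ^ 2 := by
          have : (e n)⁻¹ * e n = 1 := inv_mul_cancel₀ (hepos n).ne'
          calc (e n)⁻¹ ^ 2 * (C₂ * (L * (e n * ‖h‖)) ^ 2) = ((e n)⁻¹ * e n) ^ 2 * (C₂ * L ^ 2 * ‖h‖ ^ 2) := by ring
            _ = C₂ * L ^ 2 * ‖h‖ ^ 2 := by rw [this]; ring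
  -- the states of the difference quotients converge to `S (W h)`
  set W : Hsp →L[ℝ] Hsp := fderiv ℝ (fun y' => F.modelMap ν xF U' s y') y with hW
  have hder : HasFDerivAt (fun y' => F.modelMap ν xF U' s y') W y :=
    (((hsmooth s ⟨hs0.le, hs.2⟩).contDiffAt (hU.mem_nhds hyU)).differentiableAt (by simp)).hasFDerivAt
  have hstate : ∀ n, stateOf (v n) = F.S ((e n)⁻¹ • (F.modelMap ν xF U' s (y + ((e n)⁻¹)⁻¹ • h) - F.modelMap ν xF U' s y)) := by
    intro n
    rw [inv_inv, map_smul, map_sub, hSu _ (hmemU n) s hs3, hSu y hyU s hs3, hv]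
    show stateOf (fun x => (e n)⁻¹ • (u (y + e n • h) s x - u y s x)) = _
    rw [stateOf_const_smul' (hhon n).1 (hhon n).2.1 (hhon n).2.2,
      stateOf_sub' ((hsol _ (hmemU n)).smooth_velocity.isSmooth_slice hs3) ((hsol _ (hmemU n)).divFree s hs3)
        (hzm _ (hmemU n) s hs3) ((hsol y hyU).smooth_velocity.isSmooth_slice hs3) ((hsol y hyU).divFree s hs3) (hzm y hyU s hs3)]
  have hlimS : Tendsto (fun n => stateOf (v n)) atTop (𝓝 (F.S (W h))) := by
    have h1 := (F.S.continuous.tendsto (W h)).comp (hder.lim h hc)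
    refine h1.congr fun n => ?_
    rw [hstate n]
    rfl
  have hlim : Tendsto (fun n => ∫ x, ‖v n x - rep (F.S (W h)) x‖ ^ 2) atTop (𝓝 0) := by
    have h1 : Tendsto (fun n => ‖stateOf (v n) - F.S (W h)‖) atTop (𝓝 0) := tendsto_iff_norm_sub_tendsto_zero.1 hlimS
    have h2 : Tendsto (fun n => ‖stateOf (v n) - F.S (W h)‖ ^ 2) atTop (𝓝 0) := by simpa using h1.pow 2
    refine h2.congr fun n => ?_
    exact norm_stateOf_sub_sq' (hvhon n).1 (hvhon n).2.1 (hvhon n).2.2 _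
  -- the Gevrey-bounded honest representative of the limit
  have hf : MemLp (rep (F.S (W h))) 2 volume :=
    Lp.memLp ((F.S (W h) : Hsp) : Lp (EuclideanSpace ℝ (Fin 3)) 2 (volume : Measure (UnitAddTorus (Fin 3))))
  obtain ⟨w, hw, hwd, hwm, hwG, hae⟩ := exists_smooth_rep_of_tendsto_of_gevrey_bound hσ₂ v (fun n => (hvhon n).1)
    (fun n => (hvhon n).2.1) (fun n => (hvhon n).2.2) hvG hf hlim
  refine ⟨w, hw, hwd, hwm, hwG, ?_⟩
  apply Subtype.ext
  apply Lp.ext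
  have h1 := rep_stateOf hw hwd hwm
  unfold rep at h1 hae
  filter_upwards [h1, hae] with x e1 e2
  rw [e1, ← e2]

end Setup

end Summit.AnomalousDissipation.AnomalousDissipation.Theorems.DenseLoudDesignerForces.Ergodic

end
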